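import Summits.CriticalPhenomena.CardyFormulaZ2.Theses.CardySelfRefinement
import Literature.Probability.Percolation.KSTPeriodicCorridor
import HarnessLib.Audit

/-!
# Crux `CriticalPathRSW`, line finite-size-envelope: stub `stub_kstCorridor`

The corridor lemma of [KohlerSchindlerTassion2023, Lemma 2 and Remark 1] in the two orientations
used by the weak periodic RSW theorem (`KSTPeriodic.CorridorA`, `KSTPeriodic.CorridorB` of
`KSTPeriodicStatements.lean`), from the arm duality: a wrapper around
`KSTPeriodic.corridorA_of_armDuality` / `KSTPeriodic.corridorB_of_armDuality`
(`Literature/Probability/Percolation/KSTPeriodicCorridor.lean`).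
-/

namespace Summit.CriticalPhenomena.CardyFormulaZ2.Cruxes.CriticalPathRSW.FiniteSizeEnvelope

open Literature.Probability.Percolation

/-- **Registered stub `stub_kstCorridor`** of the line `finite-size-envelope`: the arm duality
implies the corridor lemma for horizontal and for vertical crossers.
[cite: KohlerSchindlerTassion2023, Lemma 2 and Remark 1] -/
theorem stub_kstCorridor :
    KSTPeriodic.ArmDuality → KSTPeriodic.CorridorA ∧ KSTPeriodic.CorridorB :=
  fun h => ⟨KSTPeriodic.corridorA_of_armDuality h, KSTPeriodic.corridorB_of_armDuality h⟩

end Summit.CriticalPhenomena.CardyFormulaZ2.Cruxes.CriticalPathRSW.FiniteSizeEnvelope
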